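import Literature.NumberTheory.LFunctions.WeilArchDensityTail
import Literature.NumberTheory.LFunctions.WeilWindowSuzukiProofs
import Literature.Analysis.ValidatedNumerics.TaylorModelPsi
import Literature.Analysis.ValidatedNumerics.TaylorModelMovingIntegral
import HarnessLib

/-!
# The archimedean density of Weil's explicit formula, VI: the regular part `Ψ̃` of the tail near `0` as a Taylor model

Topic `Literature/NumberTheory/LFunctions` (sequel of `WeilArchDensityTail.lean`; uses `TaylorModelPsi`, `TaylorModelMovingIntegral`).
On the EDGE panel of a window the tail `Ψ(L) = ∫_{(L,∞)} ρ` is `−½ log L + Ψ̃(L)` (`weilArchTail_eq_log`), and the regular part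
`Ψ̃ = weilArchTailReg` has to be enclosed for `L = h + λ ∈ [0, 2h]`.  We avoid Taylor models of `log` and `arctan` (the closed form)
and use instead the derivative: for `t > 0`, `Ψ̃'(t) = −ρ(t) + 1/(2t) = −K(t)` with the ANALYTIC kernel

  `K(t) = N(t) / (2φ(2t))`,  `N(t) = (e^{-t/2} − φ(2t))/t = −½ + (t/4)ψ₂(t/2) + 2ψ₂(2t)`

(`φ(u) = (1−e^{-u})/u`, `ψ₂(u) = (e^{-u}−1+u)/u²`, both entire; `weilArchTailRegKernel`, `weilArchTailRegKernel_eq_of_pos`,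
`abs_weilArchTailRegKernel_le` : `|K| ≤ 1` on `(0,1]`), so that

  `Ψ̃(L) = (log 2 + π/4) − ∫_0^L K(t) dt`   (`0 < L ≤ 1`; `weilArchTailReg_eq_an`, via the limit `Ψ̃(0⁺) = log 2 + π/4`,
  `tendsto_weilArchTailReg_zero`, and the derivative `hasDerivAt_weilArchTailReg`).

The right-hand side `weilArchTailRegAn` (defined for all `L`) is Taylor-modelled on `L = h + λ`, `|λ| ≤ h`, by `tpsi2I`/`tphiI`, a verified
division (`checkInv`) and a partial-panel integral (`partPanelTM`): `weilArchTailRegAnTM`, `tmem_weilArchTailRegAnTM`.  All proved; the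
constant `log 2 + π/4` and the approximate inverse polynomial are inputs (an `MI` with a membership hypothesis, resp. checked data).

## References
* E. Bombieri, Rend. Mat. Acc. Lincei (9) 11 (2000) 183–233, Thm 2 (the density). [Bombieri2000Weil]
* K. Makino, M. Berz, Int. J. Pure Appl. Math. 4 (2003) 379–456. [folklore]
-/

noncomputable section

open Real Set MeasureTheory Filter intervalIntegral
open scoped Topology Interval

namespace Literature.NumberTheory.LFunctions

open Literature.Analysis.ValidatedNumerics Literature.Analysis.ValidatedNumerics.PolyMP
  Literature.Analysis.ValidatedNumerics.NumericsMP Literature.Analysis.ValidatedNumerics.ExpPoly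

/-! ## The analytic kernel `K` -/

/-- The analytic kernel `K(t) = (−½ + (t/4)ψ₂(t/2) + 2ψ₂(2t)) / (2φ(2t))` (`= ρ(t) − 1/(2t)` for `t > 0`). [folklore] -/
def weilArchTailRegKernel (t : ℝ) : ℝ :=
  (-(1 / 2) + t / 4 * psi2Exp (t / 2) + 2 * psi2Exp (2 * t)) / (2 * phiExp (2 * t))

/-- **`K(t) = ρ(t) − 1/(2t)` for `t > 0`.** [cite: Bombieri2000Weil, Thm 2 (the density `e^{-t/2}/(1−e^{-2t})`)] -/
theorem weilArchTailRegKernel_eq_of_pos {t : ℝ} (ht : 0 < t) :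
    weilArchTailRegKernel t = weilArchDensity t - 1 / (2 * t) := by
  have hφ : phiExp (2 * t) = (1 - Real.exp (-(2 * t))) / (2 * t) := by rw [phiExp, if_neg (by positivity)]
  have hψ1 : psi2Exp (t / 2) = (Real.exp (-(t / 2)) - 1 + t / 2) / (t / 2) ^ 2 := by rw [psi2Exp, if_neg (by positivity)]
  have hψ2 : psi2Exp (2 * t) = (Real.exp (-(2 * t)) - 1 + 2 * t) / (2 * t) ^ 2 := by rw [psi2Exp, if_neg (by positivity)]
  have hden : 1 - Real.exp (-(2 * t)) ≠ 0 := by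
    have : Real.exp (-(2 * t)) < 1 := Real.exp_lt_one_iff.2 (by linarith)
    linarith
  rw [weilArchTailRegKernel, weilArchDensity_eq_exp_div ht.ne', hφ, hψ1, hψ2]
  field_simp
  ring

/-- **`|K(t)| ≤ 1` for `0 < t ≤ 1`** (from `e^{-t/2}/(2t) ≤ ρ(t) ≤ e^{t/2}/(2t)`). [folklore] -/
theorem abs_weilArchTailRegKernel_le {t : ℝ} (ht : 0 < t) (ht1 : t ≤ 1) : |weilArchTailRegKernel t| ≤ 1 := by
  rw [weilArchTailRegKernel_eq_of_pos ht, abs_le]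
  have hlo := exp_neg_half_div_le_weilArchDensity ht
  have hhi := weilArchDensity_le_exp_half_div ht
  have h2t : 0 < 2 * t := by positivity
  constructor
  · -- `ρ − 1/(2t) ≥ (e^{-t/2} − 1)/(2t) ≥ −1/4`
    have h1 : 1 - t / 2 ≤ Real.exp (-(t / 2)) := by linarith [Real.add_one_le_exp (-(t / 2))]
    have : (1 - t / 2) / (2 * t) ≤ weilArchDensity t := (div_le_div_of_nonneg_right h1 h2t.le).trans hlo
    have e : (1 - t / 2) / (2 * t) = 1 / (2 * t) - 1 / 4 := by field_simp; ring
    linarith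
  · -- `ρ − 1/(2t) ≤ (e^{t/2} − 1)/(2t) ≤ e^{t/2}/4 < 1`
    have h1 : Real.exp (t / 2) - 1 ≤ t / 2 * Real.exp (t / 2) := by
      have := Real.add_one_le_exp (-(t / 2))
      have hprod : Real.exp (-(t / 2)) * Real.exp (t / 2) = 1 := by rw [← Real.exp_add]; simp
      nlinarith [Real.exp_pos (t / 2)]
    have h2 : Real.exp (t / 2) ≤ Real.exp 1 := Real.exp_le_exp.2 (by linarith)
    have h3 : Real.exp 1 < 3 := lt_trans Real.exp_one_lt_d9 (by norm_num)
    have h4 : weilArchDensity t ≤ (1 + t / 2 * Real.exp (t / 2)) / (2 * t) :=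
      hhi.trans (div_le_div_of_nonneg_right (by linarith) h2t.le)
    have e : (1 + t / 2 * Real.exp (t / 2)) / (2 * t) = 1 / (2 * t) + Real.exp (t / 2) / 4 := by field_simp; ring
    rw [e] at h4
    have : Real.exp (t / 2) / 4 ≤ 1 := by linarith
    linarith

/-- `K` is measurable-equal to `ρ − 1/(2t)` on `(0,∞)`; in particular it is interval integrable on `[0, L]`, `L ≤ 1`. [folklore] -/
theorem intervalIntegrable_weilArchTailRegKernel {L : ℝ} (hL0 : 0 ≤ L) (hL1 : L ≤ 1) :
    IntervalIntegrable weilArchTailRegKernel volume 0 L := by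
  -- bounded by `1` on `(0, L]` and measurable there (as `ρ − 1/(2t)`)
  have hmeas : AEStronglyMeasurable (fun t ↦ weilArchDensity t - 1 / (2 * t)) (volume.restrict (Ι 0 L)) :=
    (measurable_weilArchDensity.sub (measurable_const.div (measurable_const.mul measurable_id))).aestronglyMeasurable
  have hK : IntervalIntegrable (fun t ↦ weilArchDensity t - 1 / (2 * t)) volume 0 L := by
    refine (intervalIntegrable_const (c := (1 : ℝ))).mono_fun' hmeas ?_
    rw [EventuallyLE, ae_restrict_iff' measurableSet_uIoc]
    refine Eventually.of_forall fun t ht ↦ ?_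
    rw [uIoc_of_le hL0] at ht
    rw [← weilArchTailRegKernel_eq_of_pos ht.1]
    exact abs_weilArchTailRegKernel_le ht.1 (ht.2.trans hL1)
  refine hK.congr fun t ht ↦ ?_
  rw [uIoc_of_le hL0] at ht
  exact (weilArchTailRegKernel_eq_of_pos ht.1).symm

/-! ## `Ψ̃`: derivative, limit at `0⁺`, integral representation -/

/-- **`Ψ̃'(L) = −K(L)` for `L > 0`.** [folklore] -/
theorem hasDerivAt_weilArchTailReg {L : ℝ} (hL : 0 < L) :
    HasDerivAt weilArchTailReg (-weilArchTailRegKernel L) L := by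
  have h1 : HasDerivAt weilArchTail (-weilArchDensity L) L := by
    refine (hasDerivAt_weilArchTailClosed hL).congr_of_eventuallyEq ?_
    filter_upwards [Ioi_mem_nhds hL] with t ht
    exact weilArchTail_eq ht
  have h2 : HasDerivAt (fun t : ℝ ↦ (1 / 2) * Real.log t) ((1 / 2) * L⁻¹) L :=
    (Real.hasDerivAt_log hL.ne').const_mul (1 / 2)
  have h := h1.add h2
  refine (h.congr_of_eventuallyEq (Eventually.of_forall fun t ↦ rfl)).congr_deriv ?_
  rw [weilArchTailRegKernel_eq_of_pos hL]
  field_simp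
  ring

/-- **`Ψ̃(L) → log 2 + π/4` as `L → 0⁺`.** [folklore] -/
theorem tendsto_weilArchTailReg_zero :
    Tendsto weilArchTailReg (𝓝[>] 0) (𝓝 (Real.log 2 + Real.pi / 4)) := by
  -- the closed form, continuous at `0`
  set f : ℝ → ℝ := fun L ↦ Real.log 2 / 2 + (1 / 2) * Real.log (1 + Real.exp (-(L / 2))) -
    (1 / 2) * Real.log (phiExp (L / 2)) + Real.arctan (Real.exp (-(L / 2))) with hf
  have hfeq : weilArchTailReg =ᶠ[𝓝[>] 0] f := by
    filter_upwards [self_mem_nhdsWithin] with L (hL : 0 < L)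
    rw [hf]; exact weilArchTailReg_eq hL
  have hf0 : f 0 = Real.log 2 + Real.pi / 4 := by rw [hf]; exact weilArchTailReg_closedForm_zero
  have hcont : ContinuousAt f 0 := by
    have he : ContinuousAt (fun L : ℝ ↦ Real.exp (-(L / 2))) 0 := by fun_prop
    have h1 : ContinuousAt (fun L : ℝ ↦ Real.log (1 + Real.exp (-(L / 2)))) 0 :=
      (Real.continuousAt_log (by positivity)).comp (continuousAt_const.add he)
    have hφ : ContinuousAt (fun L : ℝ ↦ phiExp (L / 2)) 0 := by
      have hdiv : ContinuousAt (fun L : ℝ ↦ L / 2) 0 := (continuous_id.div_const (2 : ℝ)).continuousAt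
      exact ContinuousAt.comp_of_eq continuousAt_phiExp_zero hdiv (by norm_num)
    have h2 : ContinuousAt (fun L : ℝ ↦ Real.log (phiExp (L / 2))) 0 :=
      (Real.continuousAt_log (by simp [phiExp])).comp hφ
    have h3 : ContinuousAt (fun L : ℝ ↦ Real.arctan (Real.exp (-(L / 2)))) 0 :=
      Real.continuous_arctan.continuousAt.comp he
    rw [hf]
    exact ((continuousAt_const.add (continuousAt_const.mul h1)).sub (continuousAt_const.mul h2)).add h3
  rw [← hf0]
  exact (hcont.tendsto.mono_left nhdsWithin_le_nhds).congr' hfeq.symm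

/-- The analytic regular part: `Ψ̃♮(L) = (log 2 + π/4) − ∫_0^L K`. [folklore] -/
def weilArchTailRegAn (L : ℝ) : ℝ := (Real.log 2 + Real.pi / 4) - ∫ t in (0 : ℝ)..L, weilArchTailRegKernel t

/-- **`Ψ̃ = Ψ̃♮` on `(0, 1]`.** [folklore] -/
theorem weilArchTailReg_eq_an {L : ℝ} (hL : 0 < L) (hL1 : L ≤ 1) : weilArchTailReg L = weilArchTailRegAn L := by
  have hderiv : ∀ t ∈ Ioo (0 : ℝ) L, HasDerivAt weilArchTailReg (-weilArchTailRegKernel t) t :=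
    fun t ht ↦ hasDerivAt_weilArchTailReg ht.1
  have hint : IntervalIntegrable (fun t ↦ -weilArchTailRegKernel t) volume 0 L :=
    (intervalIntegrable_weilArchTailRegKernel hL.le hL1).neg
  have hb : Tendsto weilArchTailReg (𝓝[<] L) (𝓝 (weilArchTailReg L)) :=
    (hasDerivAt_weilArchTailReg hL).continuousAt.tendsto.mono_left nhdsWithin_le_nhds
  have h := integral_eq_sub_of_hasDerivAt_of_tendsto hL hderiv hint tendsto_weilArchTailReg_zero hb
  rw [intervalIntegral.integral_neg] at h
  rw [weilArchTailRegAn]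
  linarith

/-! ## The Taylor model of `Ψ̃♮(h + λ)` -/

/-- Transport of a Taylor model along a pointwise equality of functions. [folklore] -/
theorem tmem_congr_fun {S : ℕ} {h : ℚ} {f g : ℝ → ℝ} {P : IPoly} (hf : TMem S h f P) (hfg : ∀ ρ, f ρ = g ρ) :
    TMem S h g P := fun ρ hρ ↦ by
  obtain ⟨as, has, e⟩ := hf ρ hρ
  exact ⟨as, has, by rw [← hfg, e]⟩

/-- Taylor model of `u ↦ K(h + u)` on `|u| ≤ h`: `N · (widened approximate inverse of 2φ(2t))`, `t = h + u`. [folklore] -/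
def weilArchTailRegKernelTM (S : ℕ) (h : ℚ) (D K : ℕ) (Qinv : Poly) (e : ℕ) : IPoly :=
  let Ut : IPoly := tvar S (ofRat S h)
  let N : IPoly := taddI (tconst (ofRat S (-(1 / 2))))
    (taddI (tmulI S h D (tdivNat 4 Ut) (tpsi2I S h D K (tdivNat 2 Ut))) (tsmulInt 2 (tpsi2I S h D K (tsmulInt 2 Ut))))
  tmulI S h D N (widen0 (ratPolyI S Qinv) e)

/-- The checks: `|t/2| ≤ 1`, `|2t| ≤ 1` on the panel, and the verified inverse of `2φ(2t)`. [folklore] -/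
def weilArchTailRegKernelCheck (S : ℕ) (h : ℚ) (D K : ℕ) (Qinv : Poly) (e : ℕ) : Bool :=
  let Ut : IPoly := tvar S (ofRat S h)
  decide (tabsI S h (tdivNat 2 Ut) ≤ S) && decide (tabsI S h (tsmulInt 2 Ut) ≤ S) &&
    checkInv S h D (tsmulInt 2 (tphiI S h D K (tsmulInt 2 Ut))) (ratPolyI S Qinv) e

/-- **Soundness of the kernel Taylor model.** [folklore] -/
theorem tmem_weilArchTailRegKernelTM {S : ℕ} (hS : 0 < S) {h : ℚ} (hh : 0 < h) {D K : ℕ} (hK : 0 < K)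
    {Qinv : Poly} {e : ℕ} (hc : weilArchTailRegKernelCheck S h D K Qinv e = true) :
    TMem S h (fun u ↦ weilArchTailRegKernel ((h : ℝ) + u)) (weilArchTailRegKernelTM S h D K Qinv e) := by
  unfold weilArchTailRegKernelCheck at hc
  simp only [Bool.and_eq_true, decide_eq_true_eq] at hc
  obtain ⟨⟨hB1, hB2⟩, hinv⟩ := hc
  have hh0 : 0 ≤ h := hh.le
  have hUt : TMem S h (fun u ↦ (h : ℝ) + u) (tvar S (ofRat S h)) := tmem_var (mem_ofRat S h)
  have hhalf : TMem S h (fun u ↦ ((h : ℝ) + u) / 2) (tdivNat 2 (tvar S (ofRat S h))) := by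
    simpa using tmem_divNat (n := 2) two_pos hUt
  have htwo : TMem S h (fun u ↦ 2 * ((h : ℝ) + u)) (tsmulInt 2 (tvar S (ofRat S h))) := by
    simpa using tmem_smulInt 2 hUt
  have hquart : TMem S h (fun u ↦ ((h : ℝ) + u) / 4) (tdivNat 4 (tvar S (ofRat S h))) := by
    simpa using tmem_divNat (n := 4) (by norm_num) hUt
  have hψa := tmem_psi2 hS hh0 D K hhalf hB1
  have hψb := tmem_psi2 hS hh0 D K htwo hB2
  have hφ := tmem_phi hS hh0 D hK htwo hB2
  have hN : TMem S h (fun u ↦ -(1 / 2 : ℝ) + ((h : ℝ) + u) / 4 * psi2Exp (((h : ℝ) + u) / 2) +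
      2 * psi2Exp (2 * ((h : ℝ) + u)))
      (taddI (tconst (ofRat S (-(1 / 2))))
        (taddI (tmulI S h D (tdivNat 4 (tvar S (ofRat S h))) (tpsi2I S h D K (tdivNat 2 (tvar S (ofRat S h)))))
          (tsmulInt 2 (tpsi2I S h D K (tsmulInt 2 (tvar S (ofRat S h))))))) := by
    have := tmem_add (tmem_const (h := h) (mem_ofRat S (-(1 / 2)))) (tmem_add (tmem_mul hS hh0 D hquart hψa)
      (tmem_smulInt 2 hψb))
    refine tmem_congr_fun this fun u ↦ ?_
    push_cast
    ring
  have h2φ : TMem S h (fun u ↦ 2 * phiExp (2 * ((h : ℝ) + u))) (tsmulInt 2 (tphiI S h D K (tsmulInt 2 (tvar S (ofRat S h))))) := by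
    simpa using tmem_smulInt 2 hφ
  have hinvTM := tmem_inv_of_check hS hh0 h2φ (tmem_ratPoly S h Qinv) hinv
  have hprod := tmem_mul hS hh0 D hN hinvTM
  intro u hu
  obtain ⟨as, has, ev⟩ := hprod u hu
  refine ⟨as, has, ?_⟩
  rw [← ev]
  beta_reduce
  rw [weilArchTailRegKernel, div_eq_mul_inv]

/-- Taylor model of `λ ↦ Ψ̃♮(h + λ) = C₀ − ∫_{-h}^{λ} K(h + u) du`: `C0 ∋ log 2 + π/4` an input interval, `pK` the reference
polynomial for the kernel's Taylor model. [folklore] -/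
def weilArchTailRegAnTM (S : ℕ) (h : ℚ) (D K : ℕ) (Qinv : Poly) (e : ℕ) (pK : Poly) (C0 : MI) : IPoly :=
  tsubI (tconst C0) (partPanelTM S h (weilArchTailRegKernelTM S h D K Qinv e) pK [1])

/-- **The regular part of the tail on the edge panel, enclosed**: for `0 < h`, `2h ≤ 1`, the kernel checks, and `log 2 + π/4 ∈ C0`,
`weilArchTailRegAnTM` encloses `λ ↦ Ψ̃♮(h + λ)` on `|λ| ≤ h`; and `Ψ̃♮(L) = Ψ̃(L) = Ψ(L) + ½ log L` for `0 < L ≤ 1`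
(`weilArchTailReg_eq_an`). [cite: Bombieri2000Weil, Thm 2 (the density)] -/
theorem tmem_weilArchTailRegAnTM {S : ℕ} (hS : 0 < S) {h : ℚ} (hh : 0 < h) (hh1 : 2 * h ≤ 1) {D K : ℕ} (hK : 0 < K)
    {Qinv : Poly} {e : ℕ} (hc : weilArchTailRegKernelCheck S h D K Qinv e = true) (pK : Poly) {C0 : MI}
    (hC0 : MI.mem S (Real.log 2 + Real.pi / 4) C0) :
    TMem S h (fun lam ↦ weilArchTailRegAn ((h : ℝ) + lam)) (weilArchTailRegAnTM S h D K Qinv e pK C0) := by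
  have hhr : (0 : ℝ) < h := by exact_mod_cast hh
  have hh1r : 2 * (h : ℝ) ≤ 1 := by exact_mod_cast hh1
  have hKTM := tmem_weilArchTailRegKernelTM hS hh hK hc
  -- the shifted kernel is interval integrable on `[-h, h]`
  have hfi : IntervalIntegrable (fun u ↦ weilArchTailRegKernel ((h : ℝ) + u)) volume (-(h : ℝ)) h := by
    have := (intervalIntegrable_weilArchTailRegKernel (L := 2 * h) (by linarith) hh1r).comp_add_left (h : ℝ)
    convert this using 1 <;> ring
  have hpart := tmem_partPanelTM hS hh.le hKTM hfi pK [1]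
  have hall := tmem_sub (tmem_const (h := h) hC0) hpart
  intro lam hlam
  obtain ⟨as, has, ev⟩ := hall lam hlam
  refine ⟨as, has, ?_⟩
  rw [← ev]
  beta_reduce
  rw [weilArchTailRegAn]
  have hl := abs_le.1 hlam
  have e : ∫ t in (0 : ℝ)..((h : ℝ) + lam), weilArchTailRegKernel t =
      ∫ u in (-(h : ℝ))..lam, weilArchTailRegKernel ((h : ℝ) + u) * Poly.eval [1] u := by
    have hs := intervalIntegral.integral_comp_add_left (fun t ↦ weilArchTailRegKernel t) (h : ℝ) (a := -(h : ℝ)) (b := lam)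
    simp only [add_neg_cancel] at hs
    simp only [Poly.eval, Rat.cast_one, mul_zero, add_zero, mul_one]
    rw [hs]
  rw [e]

end Literature.NumberTheory.LFunctions

end
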